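import Summits.KontsevichZagierPeriods.KontsevichZagierPeriods.Theorems.SoloInformedAlgLocalGlobal
import HarnessLib

/-!
# The DEN-calculus over `K`: the local leaves of the algorithm

Solo programme `solo-KontsevichZagierPeriods-informed`, session s107, step (x-d) of the general
two-dimensional algorithm: the LOCAL LEAVES — the points of the closed cube at which local
presentability (`SoloInformedLocallyPresentableDenK`, file `SoloInformedAlgLocalGlobal`) is
immediate — and the transport of local presentability along vertex reflections.

* **CELL-LEAF** `soloInformed_presentableDenK_gridSubst_monomial_mul` — the cell polynomial of
  `u · x^e · G` on a grid cell on whose closure `G` has no zero is a presentable denominator: it is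
  `u · ∏ⱼ ((cⱼ + xⱼ)/N)^{eⱼ} · G((c + x)/N)`, a product of cube-nondegenerate factors (a factor
  `(cⱼ + xⱼ)/N` is the monomial `xⱼ/N` if `cⱼ = 0` and a unit on the closed cell otherwise);
* **case L1** `soloInformed_locallyPresentableDenK_monomial_mul` — `u · x^e · G` is locally
  presentable at every point where `G` does not vanish;
* **VERTEX-LOCAL** `soloInformed_locallyPresentableDenK_zero_of_germs` — at the vertex `0`,
  `u · x^e · G` is locally presentable as soon as `G` has no zero near `0` other than `0` and the
  CORNER GERMS `Q(x/N)` (`N ≥ N₀`) are presentable denominators: the other small cells near `0`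
  are CELL-LEAVES;
* **reflection transport** `soloInformed_locallyPresentableDenK_of_vertexReflect` — local
  presentability of the vertex reflection `Q ∘ Φ_S` at `Φ_S p` gives local presentability of `Q`
  at `p` (the grid is `Φ_S`-stable; RULE VERTEX′), so that VERTEX-LOCAL serves every vertex.

References: M. Kontsevich, D. Zagier, *Periods* (2001), §1.2; J. Kollár, *Lectures on Resolution
of Singularities* (2007), §1.8.
-/

noncomputable section

open scoped BigOperators
open MeasureTheory Set
open Literature.NumberTheory.Transcendental Literature.NumberTheory.Transcendental.KZ

namespace Summit.KontsevichZagierPeriods.KontsevichZagierPeriods.Theorems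

variable {n : ℕ} {K : Type*} [Field K] [Algebra K ℝ]

/-! ### CELL-LEAF -/

/-- A positive natural number is non-zero in `K` (`K` embeds in `ℝ`). [this work] -/
theorem soloInformed_natCast_ne_zeroK {N : ℕ} (hN : 0 < N) : (N : K) ≠ 0 := by
  intro h
  have h' : (algebraMap K ℝ) (N : K) = 0 := by rw [h, map_zero]
  rw [map_natCast] at h'
  exact (Nat.cast_ne_zero.2 hN.ne') h'

omit [Algebra K ℝ] in
/-- The grid substitution of a variable. [this work] -/
theorem soloInformed_gridSubstK_X (s : Finset (Fin n)) (N : ℕ) (c : Fin n → ℕ) (j : Fin n) :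
    soloInformedGridSubstK s N c (MvPolynomial.X j : MvPolynomial (Fin n) K) =
      if j ∈ s then MvPolynomial.C ((c j : K) / N) + MvPolynomial.C ((N : K)⁻¹) * MvPolynomial.X j
      else MvPolynomial.X j := by
  unfold soloInformedGridSubstK
  rw [MvPolynomial.bind₁_X_right]

/-- The grid factor `cⱼ/N + xⱼ/N` is cube-nondegenerate: the monomial `xⱼ/N` if `cⱼ = 0`, a unit
on the closed cube if `cⱼ ≥ 1`. [this work] -/
theorem soloInformed_cubeNondegenerateK_gridFactor {N : ℕ} (hN : 0 < N) (cj : ℕ) (j : Fin n) :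
    SoloInformedCubeNondegenerateK
      (MvPolynomial.C ((cj : K) / N) + MvPolynomial.C ((N : K)⁻¹) * MvPolynomial.X j :
        MvPolynomial (Fin n) K) := by
  have hNK : (N : K) ≠ 0 := soloInformed_natCast_ne_zeroK hN
  rcases Nat.eq_zero_or_pos cj with hc | hc
  · subst hc
    rw [Nat.cast_zero, zero_div, map_zero, zero_add]
    exact soloInformed_cubeNondegenerateK_mul (soloInformed_cubeNondegenerateK_C (inv_ne_zero hNK))
      (soloInformed_cubeNondegenerateK_X j)
  · refine soloInformed_cubeNondegenerateK_of_forall_ne_zero fun y hy => ?_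
    have hN' : (0 : ℝ) < N := by exact_mod_cast hN
    have hc' : (0 : ℝ) < cj := by exact_mod_cast hc
    simp only [map_add, map_mul, MvPolynomial.aeval_C, MvPolynomial.aeval_X, map_div₀,
      map_natCast, map_inv₀]
    exact (add_pos_of_pos_of_nonneg (div_pos hc' hN')
      (mul_nonneg (inv_nonneg.2 hN'.le) (hy j).1)).ne'

/-- The grid substitution of a non-zero monomial is cube-nondegenerate. [this work] -/
theorem soloInformed_cubeNondegenerateK_gridSubst_monomial {N : ℕ} (hN : 0 < N)
    (c : Fin n → ℕ) (e : Fin n →₀ ℕ) {u : K} (hu : u ≠ 0) :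
    SoloInformedCubeNondegenerateK
      (soloInformedGridSubstK Finset.univ N c (MvPolynomial.monomial e u)) := by
  classical
  rw [MvPolynomial.monomial_eq, map_mul, MvPolynomial.algHom_C, Finsupp.prod, map_prod]
  refine soloInformed_cubeNondegenerateK_mul (soloInformed_cubeNondegenerateK_C hu)
    (soloInformed_cubeNondegenerateK_prod _ _ fun j _ => ?_)
  rw [map_pow, soloInformed_gridSubstK_X, if_pos (Finset.mem_univ j)]
  exact soloInformed_cubeNondegenerateK_pow (soloInformed_cubeNondegenerateK_gridFactor hN (c j) j) _

/-- **CELL-LEAF.**  Over a field `K` of real algebraic numbers: the cell polynomial of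
`u · x^e · G` (`u ≠ 0`) on a grid cell `(c + [0,1]ⁿ)/N` on whose closure `G` has no zero is a
presentable denominator. [this work] -/
theorem soloInformed_presentableDenK_gridSubst_monomial_mul
    (hK : ∀ c : K, IsAlgebraic ℚ (algebraMap K ℝ c)) (e : Fin n →₀ ℕ) {u : K} (hu : u ≠ 0)
    {G : MvPolynomial (Fin n) K} {N : ℕ} (hN : 0 < N) (c : Fin n → ℕ)
    (hG : ∀ y ∈ soloInformedCube n,
      (MvPolynomial.aeval (fun j => ((c j : ℝ) + y j) / N) G : ℝ) ≠ 0) :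
    SoloInformedPresentableDenK
      (soloInformedGridSubstK Finset.univ N c (MvPolynomial.monomial e u * G)) := by
  rw [map_mul]
  refine soloInformed_presentableDenK_of_nondegenerate hK
    (soloInformed_cubeNondegenerateK_mul
      (soloInformed_cubeNondegenerateK_gridSubst_monomial hN c e hu)
      (soloInformed_cubeNondegenerateK_of_forall_ne_zero fun y hy => ?_))
  rw [soloInformed_aeval_gridSubstK, soloInformed_gridMoveR_univ]
  exact hG y hy

/-! ### Case L1: points where the non-monomial part does not vanish -/

/-- **Case L1.**  Over a field `K` of real algebraic numbers, `u · x^e · G` (`u ≠ 0`) is locally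
presentable at every point `p` with `G(p) ≠ 0`. [this work] -/
theorem soloInformed_locallyPresentableDenK_monomial_mul
    (hK : ∀ c : K, IsAlgebraic ℚ (algebraMap K ℝ c)) (e : Fin n →₀ ℕ) {u : K} (hu : u ≠ 0)
    (G : MvPolynomial (Fin n) K) {p : Fin n → ℝ} (hp : (MvPolynomial.aeval p G : ℝ) ≠ 0) :
    SoloInformedLocallyPresentableDenK (MvPolynomial.monomial e u * G) p := by
  have hU : IsOpen {x : Fin n → ℝ | (MvPolynomial.aeval x G : ℝ) ≠ 0} :=
    isOpen_ne_fun (soloInformed_continuous_aevalK G) continuous_const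
  obtain ⟨ε, hε, hball⟩ := Metric.isOpen_iff.1 hU p hp
  exact ⟨ε, hε, fun N c hN _ hcell =>
    soloInformed_presentableDenK_gridSubst_monomial_mul hK e hu hN c fun y hy => hball (hcell y hy)⟩

/-! ### VERTEX-LOCAL: the vertex `0` -/

/-- A cell `(c + [0,1]ⁿ)/N` inside the ball `B(0, ε)` satisfies `(cⱼ + 1)/N < ε` for every `j`
(its far corner lies in the ball). [this work] -/
theorem soloInformed_cell_bound_of_ball_zero {N : ℕ} (hN : 0 < N) {c : Fin n → ℕ} {ε : ℝ}
    (hcell : ∀ x ∈ soloInformedCube n,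
      (fun j => ((c j : ℝ) + x j) / N) ∈ Metric.ball (0 : Fin n → ℝ) ε) (j : Fin n) :
    ((c j : ℝ) + 1) / N < ε := by
  have h1 : (fun _ : Fin n => (1 : ℝ)) ∈ soloInformedCube n := fun _ => ⟨zero_le_one, le_rfl⟩
  have h := hcell _ h1
  have hN' : (0 : ℝ) < N := by exact_mod_cast hN
  have hε : 0 < ε := by
    have := Metric.pos_of_mem_ball h
    exact this
  rw [Metric.mem_ball, dist_pi_lt_iff hε] at h
  have hj := h j
  rw [Real.dist_eq] at hj
  have h0 : (0 : Fin n → ℝ) j = 0 := rfl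
  rw [h0, sub_zero, abs_of_nonneg (div_nonneg (by positivity) hN'.le)] at hj
  exact hj

/-- **VERTEX-LOCAL.**  Over a field `K` of real algebraic numbers: let `Q = u · x^e · G` (`u ≠ 0`)
where `G` has no zero `y ≠ 0` in the closed cube with all `yⱼ < η`, and suppose the CORNER GERMS
`Q(x/N)`, `N ≥ N₀`, are presentable denominators.  Then `Q` is locally presentable at the vertex
`0`: a small cell at `0` is a corner germ, and every other small cell near `0` misses `0`, so `G`
has no zero on its closure (CELL-LEAF). [this work] -/
theorem soloInformed_locallyPresentableDenK_zero_of_germs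
    (hK : ∀ c : K, IsAlgebraic ℚ (algebraMap K ℝ c)) (e : Fin n →₀ ℕ) {u : K} (hu : u ≠ 0)
    {G : MvPolynomial (Fin n) K} {η : ℝ} (hη : 0 < η)
    (hG : ∀ y ∈ soloInformedCube n, (∀ j, y j < η) → y ≠ 0 → (MvPolynomial.aeval y G : ℝ) ≠ 0)
    (N₀ : ℕ)
    (hgerm : ∀ N : ℕ, N₀ < N →
      SoloInformedPresentableDenK
        (soloInformedGridSubstK Finset.univ N (fun _ => 0) (MvPolynomial.monomial e u * G))) :
    SoloInformedLocallyPresentableDenK (MvPolynomial.monomial e u * G) 0 := by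
  have hN₀ : (0 : ℝ) < (N₀ : ℝ) + 1 := by positivity
  refine ⟨min η (1 / ((N₀ : ℝ) + 1)), lt_min hη (by positivity), fun N c hN hc hcell => ?_⟩
  have hN' : (0 : ℝ) < N := by exact_mod_cast hN
  have hbound := soloInformed_cell_bound_of_ball_zero hN hcell
  rcases isEmpty_or_nonempty (Fin n) with hn | hn
  · -- dimension `0`: every cell polynomial takes the values of `Q`
    refine soloInformed_presentableDenK_congr (fun x _ => ?_) (hgerm (N₀ + 1) (Nat.lt_succ_self _))
    have hpt : soloInformedGridMoveR Finset.univ (N₀ + 1) (fun _ => 0) x =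
        soloInformedGridMoveR Finset.univ N c x := funext fun j => isEmptyElim j
    rw [soloInformed_aeval_gridSubstK, soloInformed_aeval_gridSubstK, hpt]
  · obtain ⟨j₀⟩ := hn
    -- the mesh: `(cⱼ + 1)/N < 1/(N₀+1)` forces `N₀ < N`
    have hNN : N₀ < N := by
      have h := lt_of_lt_of_le (hbound j₀) (min_le_right _ _)
      have h1 : (1 : ℝ) / N ≤ ((c j₀ : ℝ) + 1) / N :=
        div_le_div_of_nonneg_right
          (by have := (Nat.cast_nonneg (c j₀) : (0:ℝ) ≤ c j₀); linarith) hN'.le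
      have h2 : (1 : ℝ) / N < 1 / ((N₀ : ℝ) + 1) := lt_of_le_of_lt h1 h
      have h3 : (N₀ : ℝ) + 1 < N := (one_div_lt_one_div hN' hN₀).1 h2
      have h4 : N₀ + 1 < N := by exact_mod_cast h3
      omega
    by_cases hc0 : c = fun _ => 0
    · subst hc0
      exact hgerm N hNN
    · -- a cell missing the vertex: `G` has no zero on its closure
      obtain ⟨j, hj⟩ := Function.ne_iff.1 hc0
      have hj1 : (1 : ℝ) ≤ c j := by exact_mod_cast Nat.one_le_iff_ne_zero.2 hj
      refine soloInformed_presentableDenK_gridSubst_monomial_mul hK e hu hN c fun y hy => hG _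
        (fun i => ⟨div_nonneg (add_nonneg (Nat.cast_nonneg _) (hy i).1) hN'.le, ?_⟩)
        (fun i => ?_) fun h0 => ?_
      · rw [div_le_one hN']
        have hci : (c i : ℝ) + 1 ≤ N := by exact_mod_cast hc i
        linarith [(hy i).2]
      · refine lt_of_le_of_lt ?_ (lt_of_lt_of_le (hbound i) (min_le_left _ _))
        exact div_le_div_of_nonneg_right (by linarith [(hy i).2]) hN'.le
      · have h := congr_fun h0 j
        have hpos : (0 : ℝ) < ((c j : ℝ) + y j) / N := div_pos (by linarith [(hy j).1]) hN'
        exact hpos.ne' h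

/-! ### Transport of local presentability along vertex reflections -/

/-- The coordinatewise distance is preserved by the vertex move. [this work] -/
theorem soloInformed_dist_vertexMove_apply (S : Finset (Fin n)) (x y : Fin n → ℝ) (j : Fin n) :
    dist (soloInformedVertexMove S x j) (soloInformedVertexMove S y j) = dist (x j) (y j) := by
  by_cases hj : j ∈ S
  · simp only [soloInformedVertexMove, hj, if_true, Real.dist_eq]
    rw [show (1 : ℝ) - x j - (1 - y j) = -(x j - y j) by ring, abs_neg]
  · simp only [soloInformedVertexMove, hj, if_false]

/-- The vertex move is an isometry of the sup metric. [this work] -/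
theorem soloInformed_dist_vertexMove (S : Finset (Fin n)) (x y : Fin n → ℝ) :
    dist (soloInformedVertexMove S x) (soloInformedVertexMove S y) = dist x y := by
  apply le_antisymm
  · rw [dist_pi_le_iff dist_nonneg]
    intro j
    rw [soloInformed_dist_vertexMove_apply]
    exact dist_le_pi_dist x y j
  · rw [dist_pi_le_iff dist_nonneg]
    intro j
    rw [← soloInformed_dist_vertexMove_apply S]
    exact dist_le_pi_dist _ _ j

/-- The vertex move preserves the closed cube. [this work] -/
theorem soloInformed_vertexMove_mem_closedCube (S : Finset (Fin n)) {x : Fin n → ℝ}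
    (hx : x ∈ soloInformedCube n) : soloInformedVertexMove S x ∈ soloInformedCube n := fun j => by
  have h1 := (hx j).1
  have h2 := (hx j).2
  by_cases hj : j ∈ S
  · simp only [soloInformedVertexMove, hj, if_true]
    exact ⟨by linarith, by linarith⟩
  · simp only [soloInformedVertexMove, hj, if_false]
    exact ⟨h1, h2⟩

/-- The reflected cell: `Φ_S` maps the cell `c` of the `Nⁿ`-grid onto the cell `c'` with
`c'ⱼ = N − 1 − cⱼ (j ∈ S)`; pointwise, the point of the cell `c'` at `x` is the `Φ_S`-image of the
point of the cell `c` at `Φ_S x`. [this work] -/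
theorem soloInformed_gridPoint_reflect (S : Finset (Fin n)) {N : ℕ} (hN : 0 < N) {c : Fin n → ℕ}
    (hc : ∀ j, c j < N) (x : Fin n → ℝ) :
    (fun j => (((if j ∈ S then N - 1 - c j else c j : ℕ) : ℝ) + x j) / N) =
      soloInformedVertexMove S
        (fun j => ((c j : ℝ) + soloInformedVertexMove S x j) / N) := by
  funext j
  by_cases hj : j ∈ S
  · simp only [soloInformedVertexMove, hj, if_true]
    have hN' : (N : ℝ) ≠ 0 := by exact_mod_cast hN.ne'
    have hcast : ((N - 1 - c j : ℕ) : ℝ) = (N : ℝ) - 1 - c j := by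
      have h1 : c j < N := hc j
      rw [Nat.sub_sub, Nat.cast_sub (by omega), Nat.cast_add, Nat.cast_one]
      ring
    rw [hcast]
    field_simp
    ring
  · simp only [soloInformedVertexMove, hj, if_false]

/-- **Transport along vertex reflections.**  Over a field `K` of real algebraic numbers: if `Q`
has no zero on the open cube and its vertex reflection `Q ∘ Φ_S` is locally presentable at
`Φ_S p`, then `Q` is locally presentable at `p` — the grid is `Φ_S`-stable and RULE VERTEX′
transports each cell. [this work] -/
theorem soloInformed_locallyPresentableDenK_of_vertexReflect
    (hK : ∀ c : K, IsAlgebraic ℚ (algebraMap K ℝ c)) (S : Finset (Fin n))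
    {Q : MvPolynomial (Fin n) K}
    (hQ : ∀ x ∈ soloInformedOpenCube n, (MvPolynomial.aeval x Q : ℝ) ≠ 0) {p : Fin n → ℝ}
    (h : SoloInformedLocallyPresentableDenK (soloInformedVertexReflectK S Q)
      (soloInformedVertexMove S p)) :
    SoloInformedLocallyPresentableDenK Q p := by
  obtain ⟨ε, hε, hH⟩ := h
  refine ⟨ε, hε, fun N c hN hc hcell => ?_⟩
  -- the reflected cell `c'`
  have hc' : ∀ j, (if j ∈ S then N - 1 - c j else c j) < N := fun j => by
    by_cases hj : j ∈ S
    · rw [if_pos hj]; have := hc j; omega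
    · rw [if_neg hj]; exact hc j
  have hB := hH N (fun j => if j ∈ S then N - 1 - c j else c j) hN hc' fun x hx => by
    rw [soloInformed_gridPoint_reflect S hN hc x, Metric.mem_ball, soloInformed_dist_vertexMove]
    exact hcell _ (soloInformed_vertexMove_mem_closedCube S hx)
  -- RULE VERTEX′ from the reflected cell polynomial to the cell polynomial
  refine soloInformed_presentableDenK_of_eq_vertexMove hK S hB (fun x hx => ?_) fun x hx => ?_
  · rw [soloInformed_aeval_gridSubstK, soloInformed_aeval_vertexReflectK]
    exact hQ _ (soloInformed_vertexMove_mem S (soloInformed_gridMoveR_mem_openCube _ hc' hx))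
  · rw [soloInformed_aeval_gridSubstK, soloInformed_aeval_gridSubstK,
      soloInformed_aeval_vertexReflectK, soloInformed_gridMoveR_univ, soloInformed_gridMoveR_univ,
      soloInformed_gridPoint_reflect S hN hc, soloInformed_vertexMove_vertexMove,
      soloInformed_vertexMove_vertexMove]

end Summit.KontsevichZagierPeriods.KontsevichZagierPeriods.Theorems
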